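import Summits.BirchSwinnertonDyer.Rank1Residual.Additive.TwistPartnerForcedTower
import Summits.BirchSwinnertonDyer.Rank1Residual.Additive.TameBranchRigidity
import HarnessLib

/-!
# The conjugate forced partners: AT MOST ONE is tower-bounded (tuple rigidity) — completeness of
# the sign certificate of the defect-3/4/6 tame-branch route, fact-free half
# (cell `b2b-bsdres`, sub-cell additive-p2 = X3♯(G-ord)/X4♯(G-ord), gen 26)

HONEST FRAMING (cell `b2b-bsdres`, run/shared/lean/b2b/bsd-rank1-residual/, verbatim in every
file): the goal of the cell is to DELETE the COMBINATION-SHAPED residual classes of the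
Birch–Swinnerton-Dyer formula for ALL analytic-rank `≤ 1` elliptic curves over `ℚ` — "full BSD
formula for every rank `≤ 1` curve in class `C`" assembled STRICTLY from published theorems — so
that the rank-`≤ 1` remainder becomes exactly the CONSTRUCTION-SHAPED classes, which are TYPED
(missing-input `Prop`s), NOT attempted. This is not "finishing BSD". Sub-cell additive-p2: the
classes X3♯(G-ord) / X4♯(G-ord) are CONSTRUCTION-SHAPED and stay so; labels / RESIDUAL-MAP marks
UNCHANGED; nothing is booked. Theorems only; no named fact, no definition, no `sorry`.

## What

Gen 25 reduced the defect-`3/4/6` analytic input to Delbourgo 1998 Thm. 1 (named fact) plus, per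
pair, THREE FINITE data: the unit root `ã` of `X² − a_w(E_F)X + p`, a SIGN CERTIFICATE (one tower
value of the forced partner of the CONJUGATE character `χ⁻¹` beyond the plus-symbol bound — it
decides the one bit "`χ` or `χ⁻¹`" that print leaves open, p. 130 "if not, twist by `ε` instead of
`ε⁻¹`"), and one unit Riemann sum; the sign certificate was shown SUFFICIENT
(`towerBounded_forced_of_thm1_of_signCert`). This file is the fact-free half of "it is also
NECESSARY": **at most one of the conjugate forced partners is tower-bounded.** For `p` odd,
`χ⁻¹ ≠ χ`, `‖ã‖ = 1`, `U_p[·]⁺_f = 0`: if the forced partner of `(χ⁻¹, ã)` is bounded on the tower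
`{a/pⁿ}`, EVERY E-normalised tame branch of `(ι∘χ, ã)` VANISHES
(`IsTameBranchOf.eq_zero_of_towerBounded_forced_inv`: the tower bridge of gen 24 gives a witness for
`χ⁻¹`, and TUPLE RIGIDITY `IsTameBranchOf.eq_zero_or_tuple_eq`, gen 21, pins the character of a
non-zero witness). A NON-ZERO witness for `χ` — supplied by `[0]⁺_f ≠ 0` (`L(E,1) ≠ 0`), or by ONE
non-vanishing even twisted symbol sum `∑_b κ(b)[b/p^m]⁺_f ≠ 0` at a wild character `κ` of conductor
`p^m ≥ p²` (`IsTameBranchOf.ne_zero_of_nonvanishing`; the datum is symmetric in `χ ↔ χ⁻¹`) —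
therefore makes the conjugate partner UNBOUNDED on the tower: a sign certificate against `χ⁻¹`
EXISTS at every bound (`forall_exists_lt_norm_forced_inv_of_towerBounded`). The half with Delbourgo
1998 Thm. 1 (exactly one; decidability of the sign bit) is `TwistPartnerForcedDichotomyOfDelbourgo`.

Not claimed: WHICH character is bounded (print decides it by ordinarity of `f ⊗ ε̄`, not by a
formula; census dictionary `ω^{t(E,p)}` = EVIDENCE); anything at `L(E,1) = 0` without a non-vanishing
twisted value (Rohrlich's theorem at `p ∣ N` is not a tree object). Nothing booked.

References: Delbourgo, Compositio Math. 113 (1998) Thm. 1, p. 130 [Delbourgo1998];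
Mazur–Tate–Teitelbaum, Invent. Math. 84 (1986) §I.8, §I.10–I.14 [MazurTateTeitelbaum1986Invent]. -/

noncomputable section

open scoped Classical MatrixGroups ModularForm NumberField

open CongruenceSubgroup IsDedekindDomain WeierstrassCurve NumberField
  Literature.NumberTheory.EllipticCurves
  Literature.NumberTheory.EllipticCurves.ModularForms
  Literature.NumberTheory.EllipticCurves.Rank1Residual

namespace Summit.BirchSwinnertonDyer.Rank1Residual.Additive

namespace TwistPartner

/-! ### §1 At most one of the conjugate forced partners is tower-bounded (no named fact) -/

section AtMostOne

variable {p : ℕ} [hp : Fact p.Prime] {N : ℕ} [NeZero N] {f : CuspForm (Gamma0 N) 2}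
  {χ : MulChar (ZMod p) ℚ_[p]} {ã : ℚ_[p]}

/-- **The tower bridge without the Riemann sums**: `χ ≠ 1`, `‖ã‖ = 1`, `U_p[·]⁺_f = 0` and the
forced partner of `(χ, ã)` bounded on the tower `{a/pⁿ}` give an E-normalised tame branch `B` of
`(ι∘χ, ã)` (`IsTameBranchOf f p (ι∘χ) ã B`) whose coefficients obey every tower bound of the plus
symbols. (`exists_isTameBranchOf_riemannSum_of_towerBounded_forced` with its sums instantiated.)
[cite: MazurTateTeitelbaum1986Invent, §I.10–I.14] -/
theorem exists_isTameBranchOf_of_towerBounded_forced (hχ : χ ≠ 1) (hã : ‖ã‖ = 1)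
    (hU0 : ∀ s, ∑ d : ZMod p, ratPlusSymbol f (s + (d.val : ℚ) / p) = 0) {C₀ : ℝ}
    (hC₀ : ∀ (n : ℕ) (a : ℤ),
      ‖forced χ (fun r ↦ ((ratPlusSymbol f r : ℚ) : ℚ_[p])) ã ((a : ℚ) / (p : ℚ) ^ n)‖ ≤ C₀) :
    ∃ B : PowerSeries ℚ_[p], IsTameBranchOf f p (χ.ringHomComp (algebraMap ℚ_[p] ℂ_[p])) ã B ∧
      ∀ C : ℝ, (∀ (n : ℕ) (a : ℤ), ‖((ratPlusSymbol f ((a : ℚ) / (p : ℚ) ^ n) : ℚ) : ℚ_[p])‖ ≤ C) →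
        ∀ j : ℕ, ‖PowerSeries.coeff j B‖ ≤ C := by
  obtain ⟨B, hB, hint, -⟩ := exists_isTameBranchOf_riemannSum_of_towerBounded_forced
    (RS := fun k n ↦
      ∑ᶠ ξ : rootsOfUnity (Literature.NumberTheory.EllipticCurves.torsionOrder p) ℤ_[p],
        ∑ s : ZMod (p ^ n),
        twistPartnerMeasure χ
            (TwistPartner.forced χ (fun r ↦ ((ratPlusSymbol f r : ℚ) : ℚ_[p])) ã) ã
            ((ratPlusSymbol f 0 : ℚ) : ℚ_[p]) (n + cyclotomicExponent p)
            (PadicInt.toZModPow (n + cyclotomicExponent p) ((ξ : ℤ_[p]ˣ) : ℤ_[p]) *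
              (cyclotomicGenerator p : ZMod (p ^ (n + cyclotomicExponent p))) ^ s.val) *
          ((s.val.choose k : ℕ) : ℚ_[p]))
    (fun _ _ ↦ rfl) hχ hã hU0 hC₀
  exact ⟨B, hB, hint⟩

omit [NeZero N] in
/-- **A non-vanishing datum makes every tame branch non-zero.** For `α ≠ 0`: if `[0]⁺_f ≠ 0`
(i.e. `L(E,1) ≠ 0`), or if ONE even primitive character `κ` of conductor `p^m ≥ p²` and `p`-power
order has `∑_b κ(b)[b/p^m]⁺_f ≠ 0`, then every `B` with `IsTameBranchOf f p ε α B` is non-zero — for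
EVERY `ε` (the datum is symmetric in `ε ↔ ε̄`): `B(0) = α⁻¹[0]⁺_f`, resp. the interpolation row at `κ`
has the non-zero factor `α^{−m}p⁻¹τ(ε, ψ_κ)` (`tameGaussSum_ne_zero`). [folklore]
[cite: MazurTateTeitelbaum1986Invent, §I.8, §I.14 (14.3)] -/
theorem _root_.Summit.BirchSwinnertonDyer.Rank1Residual.Additive.IsTameBranchOf.ne_zero_of_nonvanishing
    {ε : DirichletCharacter ℂ_[p] p} {α : ℚ_[p]} {B : PowerSeries ℚ_[p]}
    (h : IsTameBranchOf f p ε α B) (hα : α ≠ 0)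
    (hND : ratPlusSymbol f 0 ≠ 0 ∨
      ∃ (m : ℕ) (κ : DirichletCharacter ℂ_[p] (p ^ m)), 2 ≤ m ∧ κ.IsPrimitive ∧ κ.Even ∧
        (∃ j : ℕ, orderOf κ = p ^ j) ∧ ratTwistedSymbolSum f κ ≠ 0) :
    B ≠ 0 := by
  rintro rfl
  rcases hND with h0 | ⟨m, κ, hm, hκ, heven, hord, hS⟩
  · have hc := h.constantCoeff
    rw [map_zero] at hc
    have : (ratPlusSymbol f 0 : ℚ_[p]) = 0 := by
      have h1 : α⁻¹ * (ratPlusSymbol f 0 : ℚ_[p]) = 0 := hc.symm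
      rcases mul_eq_zero.mp h1 with h2 | h2
      · exact absurd (inv_eq_zero.mp h2) hα
      · exact h2
    exact h0 (by exact_mod_cast this)
  · have hsum := h.2.2 m hm κ hκ heven hord
    simp only [map_zero, zero_mul] at hsum
    have hval : algebraMap ℚ_[p] ℂ_[p] (α⁻¹ ^ m * (p : ℚ_[p])⁻¹) * tameGaussSum p ε κ *
        ratTwistedSymbolSum f κ = 0 := hsum.unique hasSum_zero
    have hp0 : (p : ℚ_[p]) ≠ 0 := Nat.cast_ne_zero.mpr hp.out.ne_zero
    have hc : algebraMap ℚ_[p] ℂ_[p] (α⁻¹ ^ m * (p : ℚ_[p])⁻¹) ≠ 0 := by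
      rw [map_ne_zero_iff _ (algebraMap ℚ_[p] ℂ_[p]).injective]
      exact mul_ne_zero (pow_ne_zero _ (inv_ne_zero hα)) (inv_ne_zero hp0)
    have hτ : tameGaussSum p ε κ ≠ 0 := tameGaussSum_ne_zero hm hκ ε
    exact hS ((mul_eq_zero.mp hval).resolve_left (mul_ne_zero hc hτ))

/-- **AT MOST ONE: a tower-bounded CONJUGATE partner kills every tame branch of `χ`.** `p` odd,
`χ⁻¹ ≠ χ` (e.g. `χ` of order `3, 4, 6`), `‖ã‖ = 1`, `U_p[·]⁺_f = 0`. If the forced partner of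
`(χ⁻¹, ã)` is bounded on the tower then every `B` with `IsTameBranchOf f p (ι∘χ) ã B` is `0`:
the conjugate partner yields a witness `B'` for `(ι∘χ⁻¹, ã)` (tower bridge), and TUPLE RIGIDITY
(`IsTameBranchOf.eq_zero_or_tuple_eq`: a non-zero witness pins the character) would force
`ι∘χ⁻¹ = ι∘χ` if `B ≠ 0`. [folklore] [cite: MazurTateTeitelbaum1986Invent, §I.10–I.14] -/
theorem _root_.Summit.BirchSwinnertonDyer.Rank1Residual.Additive.IsTameBranchOf.eq_zero_of_towerBounded_forced_inv
    (hp2 : p ≠ 2) (hχ : χ⁻¹ ≠ χ) (hã : ‖ã‖ = 1)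
    (hU0 : ∀ s, ∑ d : ZMod p, ratPlusSymbol f (s + (d.val : ℚ) / p) = 0)
    (hinv : ∃ C₁ : ℝ, ∀ (n : ℕ) (a : ℤ),
      ‖forced χ⁻¹ (fun r ↦ ((ratPlusSymbol f r : ℚ) : ℚ_[p])) ã ((a : ℚ) / (p : ℚ) ^ n)‖ ≤ C₁)
    {B : PowerSeries ℚ_[p]} (hB : IsTameBranchOf f p (χ.ringHomComp (algebraMap ℚ_[p] ℂ_[p])) ã B) :
    B = 0 := by
  have hχ1' : χ⁻¹ ≠ 1 := fun h ↦ hχ (by rw [h]; exact (inv_eq_one.mp h).symm)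
  obtain ⟨C₁, hC₁⟩ := hinv
  obtain ⟨B', hB', -⟩ := exists_isTameBranchOf_of_towerBounded_forced hχ1' hã hU0 hC₁
  by_contra hne
  rcases hB.eq_zero_or_tuple_eq hp2 hB' hne with ⟨h0, -⟩ | ⟨hεε, -, -⟩
  · rw [h0, norm_zero] at hã
    exact zero_ne_one hã
  · exact hχ (MulChar.injective_ringHomComp (algebraMap ℚ_[p] ℂ_[p]).injective hεε)

/-- **A non-zero witness for `χ` makes the conjugate partner UNBOUNDED on the tower** (contrapositive
of `IsTameBranchOf.eq_zero_of_towerBounded_forced_inv`). [folklore] -/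
theorem not_towerBounded_forced_inv_of_ne_zero (hp2 : p ≠ 2) (hχ : χ⁻¹ ≠ χ) (hã : ‖ã‖ = 1)
    (hU0 : ∀ s, ∑ d : ZMod p, ratPlusSymbol f (s + (d.val : ℚ) / p) = 0)
    {B : PowerSeries ℚ_[p]} (hB : IsTameBranchOf f p (χ.ringHomComp (algebraMap ℚ_[p] ℂ_[p])) ã B)
    (hne : B ≠ 0) :
    ¬ ∃ C₁ : ℝ, ∀ (n : ℕ) (a : ℤ),
      ‖forced χ⁻¹ (fun r ↦ ((ratPlusSymbol f r : ℚ) : ℚ_[p])) ã ((a : ℚ) / (p : ℚ) ^ n)‖ ≤ C₁ :=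
  fun hinv ↦ hne (hB.eq_zero_of_towerBounded_forced_inv hp2 hχ hã hU0 hinv)

/-- **AT MOST ONE of the conjugate forced partners is tower-bounded, given a non-vanishing datum.**
`p` odd, `χ⁻¹ ≠ χ`, `‖ã‖ = 1`, `U_p[·]⁺_f = 0`, and `[0]⁺_f ≠ 0` or one non-vanishing even wild
twisted symbol sum: the forced partners of `(χ, ã)` and `(χ⁻¹, ã)` are NOT BOTH bounded on the
tower. [folklore] [cite: MazurTateTeitelbaum1986Invent, §I.10–I.14] -/
theorem not_towerBounded_forced_and_inv_of_nonvanishing (hp2 : p ≠ 2) (hχ : χ⁻¹ ≠ χ)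
    (hã : ‖ã‖ = 1) (hU0 : ∀ s, ∑ d : ZMod p, ratPlusSymbol f (s + (d.val : ℚ) / p) = 0)
    (hND : ratPlusSymbol f 0 ≠ 0 ∨
      ∃ (m : ℕ) (κ : DirichletCharacter ℂ_[p] (p ^ m)), 2 ≤ m ∧ κ.IsPrimitive ∧ κ.Even ∧
        (∃ j : ℕ, orderOf κ = p ^ j) ∧ ratTwistedSymbolSum f κ ≠ 0) :
    ¬ ((∃ C₀ : ℝ, ∀ (n : ℕ) (a : ℤ),
        ‖forced χ (fun r ↦ ((ratPlusSymbol f r : ℚ) : ℚ_[p])) ã ((a : ℚ) / (p : ℚ) ^ n)‖ ≤ C₀) ∧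
      ∃ C₁ : ℝ, ∀ (n : ℕ) (a : ℤ),
        ‖forced χ⁻¹ (fun r ↦ ((ratPlusSymbol f r : ℚ) : ℚ_[p])) ã ((a : ℚ) / (p : ℚ) ^ n)‖ ≤ C₁) := by
  rintro ⟨⟨C₀, hC₀⟩, hinv⟩
  have hχ1 : χ ≠ 1 := fun h ↦ hχ (by rw [h, inv_one])
  have hα : ã ≠ 0 := fun h ↦ by rw [h, norm_zero] at hã; exact zero_ne_one hã
  obtain ⟨B, hB, -⟩ := exists_isTameBranchOf_of_towerBounded_forced hχ1 hã hU0 hC₀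
  exact not_towerBounded_forced_inv_of_ne_zero hp2 hχ hã hU0 hB (hB.ne_zero_of_nonvanishing hα hND)
    hinv

/-- **COMPLETENESS OF THE SIGN CERTIFICATE (no fact).** `p` odd, `χ⁻¹ ≠ χ`, `‖ã‖ = 1`,
`U_p[·]⁺_f = 0`, a non-vanishing datum: if the forced partner of `(χ, ã)` is tower-bounded, then the
forced partner of the conjugate `(χ⁻¹, ã)` EXCEEDS EVERY BOUND somewhere on the tower — for every
`C` there are `n₀, a₀` with `C < ‖forced χ⁻¹ [·]⁺_f ã (a₀/p^{n₀})‖_p`: a sign certificate against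
`χ⁻¹` exists at every level of demand (the census's two-sided search terminates on the unbounded
side). [folklore] [cite: MazurTateTeitelbaum1986Invent, §I.10–I.14] -/
theorem forall_exists_lt_norm_forced_inv_of_towerBounded (hp2 : p ≠ 2) (hχ : χ⁻¹ ≠ χ)
    (hã : ‖ã‖ = 1) (hU0 : ∀ s, ∑ d : ZMod p, ratPlusSymbol f (s + (d.val : ℚ) / p) = 0)
    (hND : ratPlusSymbol f 0 ≠ 0 ∨
      ∃ (m : ℕ) (κ : DirichletCharacter ℂ_[p] (p ^ m)), 2 ≤ m ∧ κ.IsPrimitive ∧ κ.Even ∧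
        (∃ j : ℕ, orderOf κ = p ^ j) ∧ ratTwistedSymbolSum f κ ≠ 0)
    (hbd : ∃ C₀ : ℝ, ∀ (n : ℕ) (a : ℤ),
      ‖forced χ (fun r ↦ ((ratPlusSymbol f r : ℚ) : ℚ_[p])) ã ((a : ℚ) / (p : ℚ) ^ n)‖ ≤ C₀)
    (C : ℝ) :
    ∃ (n₀ : ℕ) (a₀ : ℤ),
      C < ‖forced χ⁻¹ (fun r ↦ ((ratPlusSymbol f r : ℚ) : ℚ_[p])) ã ((a₀ : ℚ) / (p : ℚ) ^ n₀)‖ := by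
  by_contra hno
  push Not at hno
  exact not_towerBounded_forced_and_inv_of_nonvanishing hp2 hχ hã hU0 hND ⟨hbd, C, hno⟩

end AtMostOne

end TwistPartner

end Summit.BirchSwinnertonDyer.Rank1Residual.Additive

end
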